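import Literature.Computability.Complexity.TimeBoundsProofs
import HarnessLib

/-!
# The halting guard: a `TM2` machine that halts only in its initial state

Toolkit lemma for universal simulations over Mathlib's multi-stack machines `Turing.FinTM2`
(Arora–Barak 2009, §1.4, "machines as strings"; Thm. 1.9). Mathlib's output convention
`Turing.TM2OutputsInTime tm l (some l') m` asks a run to reach EXACTLY the configuration
`Turing.haltList tm l'` — label `none`, internal state reset to `tm.initialState`, all stacks but
the output stack empty — whereas a simulation that codes configurations by (program counter,
stacks), such as the flat normal form `FlatProg.trCfg` of `FlatPrograms.lean` (halted ↦ the one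
address `haltAddr`, the internal state being folded into the program counter and FORGOTTEN on
halting), cannot see in which internal state the simulated machine halted. This file removes the
discrepancy on the machine side, once and for all: every machine `tm` is replaced by its
**halting guard** `HaltGuard.guard tm`, which behaves like `tm` except that it halts only when
`tm` halts in its initial state and DIVERGES (enters a looping label) when `tm` halts in any
other state — so that "halted with stacks `S`" for the guard means "reached `haltList`" for `tm`.

* `HaltGuard.trStmt init q` — the statement translation: labels wrapped in `some`, the leaf
  `halt` replaced by `branch (· = init) halt (goto none)`; `HaltGuard.guard tm : FinTM2` — labels
  `Option tm.Λ`, the new label `none` looping (`goto none`), everything else unchanged;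
  `HaltGuard.guardAux M : TM2ComputableAux Γ₀ Γ₁` — the bundled form (same alphabet
  identifications);
* `HaltGuard.stepAux_trStmt` — one statement computes the *diverted* embedded result
  (`HaltGuard.divert`); `HaltGuard.proper` / `HaltGuard.guardAux_proper` — **the guard halts
  only in its initial state**; `HaltGuard.iterate_φ_of_iterate`, `HaltGuard.of_iterate_φ` — runs
  correspond along the embedding `HaltGuard.φ` (forward: exactly; backward: up to entering the
  loop);
* `HaltGuard.outputsInTime_iff`, **`HaltGuard.outputsWithin_guardAux_iff`** — the guard has the
  same outputs within the same time: `(guardAux M).OutputsWithin x y m ↔ M.OutputsWithin x y m`.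

First client: the clocked universal acceptance test (`ClockedUniversalAcceptance.lean`, its
proof file), whose soundness needs exactly "flat halting configuration ⟹ `haltList`".

Mathlib has no such normalisation (searched `Computability/TuringMachine/*`: `TM2to1`,
`TM2ComputableAux` identity/composition only); everything here is proved.

## References

* S. Arora, B. Barak, *Computational Complexity: A Modern Approach*, CUP 2009, §1.4 (machines as
  strings), Thm. 1.9, §1.3.1 (robustness of the model under such syntactic transformations)
  [AroraBarakCC2009].
* Mathlib, `Mathlib/Computability/TuringMachine/StackTuringMachine.lean` (`Turing.TM2.stepAux`),
  `…/Computable.lean` (`Turing.FinTM2`, `Turing.haltList`, `Turing.TM2OutputsInTime`).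
-/

noncomputable section

namespace Literature.Computability.Complexity

namespace HaltGuard

open Turing Function

/-! ### Statements -/

section Stmt

variable {K : Type} {Γ : K → Type} {Λ σ : Type}

/-- **Translation of statements**: labels are wrapped in `some`, and the leaf `halt` becomes
"halt if the state is `init`, otherwise go to the looping label `none`". [folklore] -/
def trStmt (init : σ) [DecidableEq σ] : TM2.Stmt Γ Λ σ → TM2.Stmt Γ (Option Λ) σ
  | .push k f q => .push k f (trStmt init q)
  | .peek k f q => .peek k f (trStmt init q)
  | .pop k f q => .pop k f (trStmt init q)
  | .load f q => .load f (trStmt init q)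
  | .branch p q₁ q₂ => .branch p (trStmt init q₁) (trStmt init q₂)
  | .goto f => .goto fun v => some (f v)
  | .halt => .branch (fun v => decide (v = init)) .halt (.goto fun _ => none)

/-- The embedding of configurations: labels wrapped in `some`. [folklore] -/
def φ (C : TM2.Cfg Γ Λ σ) : TM2.Cfg Γ (Option Λ) σ := ⟨C.l.map some, C.var, C.stk⟩

/-- `φ` is injective. [folklore] -/
theorem φ_injective : Function.Injective (φ (Γ := Γ) (Λ := Λ) (σ := σ)) := by
  rintro ⟨l, v, S⟩ ⟨l', v', S'⟩ h
  have hl : l.map some = l'.map some := congrArg TM2.Cfg.l h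
  have hv : v = v' := congrArg TM2.Cfg.var h
  have hS : S = S' := congrArg TM2.Cfg.stk h
  rw [Option.map_injective (Option.some_injective Λ) hl, hv, hS]

/-- The label of an embedded configuration is `none` iff the original one is. [folklore] -/
theorem φ_l_eq_none_iff (C : TM2.Cfg Γ Λ σ) : (φ C).l = none ↔ C.l = none := by
  simp [φ]

/-- The label of an embedded configuration is never the looping label. [folklore] -/
theorem φ_l_ne_loop (C : TM2.Cfg Γ Λ σ) : (φ C).l ≠ some none := by
  cases h : C.l <;> simp [φ, h]

/-- The diverted result of a statement: the looping configuration if the statement halted in a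
state other than `init`, the embedded result otherwise. [folklore] -/
def divert (init : σ) [DecidableEq σ] (D : TM2.Cfg Γ Λ σ) : TM2.Cfg Γ (Option Λ) σ :=
  if D.l = none ∧ D.var ≠ init then ⟨some none, D.var, D.stk⟩ else φ D

/-- **One statement**: the translated statement computes the diverted result. [folklore] -/
theorem stepAux_trStmt [DecidableEq K] (init : σ) [DecidableEq σ] : ∀ (q : TM2.Stmt Γ Λ σ) (v : σ) (S : ∀ k, List (Γ k)),
    TM2.stepAux (trStmt init q) v S = divert init (TM2.stepAux q v S)
  | .push k f q, v, S => by simp only [trStmt, TM2.stepAux]; exact stepAux_trStmt init q _ _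
  | .peek k f q, v, S => by simp only [trStmt, TM2.stepAux]; exact stepAux_trStmt init q _ _
  | .pop k f q, v, S => by simp only [trStmt, TM2.stepAux]; exact stepAux_trStmt init q _ _
  | .load f q, v, S => by simp only [trStmt, TM2.stepAux]; exact stepAux_trStmt init q _ _
  | .branch p q₁ q₂, v, S => by
    simp only [trStmt, TM2.stepAux]
    cases p v
    · exact stepAux_trStmt init q₂ _ _
    · exact stepAux_trStmt init q₁ _ _
  | .goto f, v, S => by simp [trStmt, TM2.stepAux, divert, φ]
  | .halt, v, S => by
    simp only [trStmt, TM2.stepAux, divert]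
    by_cases h : v = init
    · subst h; simp [φ]
    · simp [h]

/-- A diverted result with label `none` is in state `init`. [folklore] -/
theorem var_of_divert_l_eq_none (init : σ) [DecidableEq σ] {D : TM2.Cfg Γ Λ σ}
    (h : (divert init D).l = none) : (divert init D).var = init := by
  unfold divert at h ⊢
  by_cases hc : D.l = none ∧ D.var ≠ init
  · rw [if_pos hc] at h
    exact absurd h (Option.some_ne_none _)
  · rw [if_neg hc] at h ⊢
    rw [φ_l_eq_none_iff] at h
    simp only [not_and, not_not] at hc
    exact hc h

end Stmt

/-! ### Machines -/

section Machine

variable (tm : FinTM2)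

open scoped Classical in
/-- **The guarded machine**: same stacks, alphabets and states; labels `Option tm.Λ` with the
extra looping label `none` (statement `goto none`); every statement translated by `trStmt`.
It halts exactly when `tm` halts in its initial state, and loops forever when `tm` halts in any
other state. [folklore] -/
@[reducible] def guard : FinTM2 where
  K := tm.K
  kDecidableEq := tm.kDecidableEq
  kFin := tm.kFin
  k₀ := tm.k₀
  k₁ := tm.k₁
  Γ := tm.Γ
  Λ := Option tm.Λ
  main := some tm.main
  ΛFin := @instFintypeOption tm.Λ tm.ΛFin
  σ := tm.σ
  initialState := tm.initialState
  σFin := tm.σFin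
  Γk₀Fin := tm.Γk₀Fin
  m := fun l => l.elim (.goto fun _ => none) fun l => trStmt tm.initialState (tm.m l)

/-- The looping label loops. [folklore] -/
theorem step_loop (v : tm.σ) (S : ∀ k, List (tm.Γ k)) :
    (guard tm).step ⟨some none, v, S⟩ = some ⟨some none, v, S⟩ := rfl

/-- Iterating from the looping configuration stays there. [folklore] -/
theorem iterate_loop (v : tm.σ) (S : ∀ k, List (tm.Γ k)) (n : ℕ) :
    (flip bind (guard tm).step)^[n] (some ⟨some none, v, S⟩) = some ⟨some none, v, S⟩ := by
  induction n with
  | zero => rfl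
  | succ n ih => rw [TM2Comp.iterate_bind_succ, step_loop]; exact ih

/-- An embedded halted configuration is halted. [folklore] -/
theorem step_φ_none (v : tm.σ) (S : ∀ k, List (tm.Γ k)) :
    (guard tm).step (φ (⟨none, v, S⟩ : tm.Cfg)) = none := rfl

/-- `tm` is halted at label `none`. [folklore] -/
theorem step_none (v : tm.σ) (S : ∀ k, List (tm.Γ k)) : tm.step ⟨none, v, S⟩ = none := rfl

/-- `tm` steps from a running configuration to the statement's result. [folklore] -/
theorem step_some (l : tm.Λ) (v : tm.σ) (S : ∀ k, List (tm.Γ k)) :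
    tm.step ⟨some l, v, S⟩ = some (TM2.stepAux (tm.m l) v S) := rfl

open scoped Classical in
/-- The step of the guarded machine on an embedded running configuration: the diverted result.
[folklore] -/
theorem step_φ_some (l : tm.Λ) (v : tm.σ) (S : ∀ k, List (tm.Γ k)) :
    (guard tm).step (φ (⟨some l, v, S⟩ : tm.Cfg)) = some (divert tm.initialState (TM2.stepAux (tm.m l) v S)) := by
  show some (TM2.stepAux (trStmt tm.initialState (tm.m l)) v S) = _
  rw [stepAux_trStmt]

open scoped Classical in
/-- **Properness of the guarded machine**: it only ever halts in its initial state. [folklore] -/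
theorem proper {X Y : (guard tm).Cfg} (h : (guard tm).step X = some Y) (hY : Y.l = none) :
    Y.var = tm.initialState := by
  obtain ⟨_ | _ | l, v, S⟩ := X
  · exact absurd h (by simp [FinTM2.step, TM2.step])
  · have hY' : Y = ⟨some none, v, S⟩ := (Option.some.inj ((step_loop tm v S).symm.trans h)).symm
    subst hY'
    exact absurd hY (by simp)
  · have h' := step_φ_some tm l v S
    change (guard tm).step ⟨some (some l), v, S⟩ = _ at h'
    rw [h] at h'
    have hY' := Option.some.inj h'
    subst hY'
    exact var_of_divert_l_eq_none _ hY

/-- Only the last configuration of a run can be halted. [folklore] -/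
theorem not_halted_of_iterate {n : ℕ} {C' D : tm.Cfg} (h : (flip bind tm.step)^[n] (some C') = some D)
    (hD : D.l = none → D.var = tm.initialState) : ¬ (C'.l = none ∧ C'.var ≠ tm.initialState) := by
  obtain ⟨l', v', S'⟩ := C'
  rintro ⟨h1, h2⟩
  simp only at h1 h2
  subst h1
  cases n with
  | zero =>
    have hCD : (⟨none, v', S'⟩ : tm.Cfg) = D := Option.some.inj h
    subst hCD
    exact h2 (hD rfl)
  | succ n =>
    rw [TM2Comp.iterate_bind_succ, step_none, TM2Comp.iterate_bind_none] at h
    cases h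

/-- **Runs, forward**: a run of `tm` ending in a configuration that, if halted, is in the initial
state, is reproduced by the guarded machine on the embedded configurations. [folklore] -/
theorem iterate_φ_of_iterate : ∀ (n : ℕ) (C : tm.Cfg) {D : tm.Cfg},
    (flip bind tm.step)^[n] (some C) = some D → (D.l = none → D.var = tm.initialState) →
      (flip bind (guard tm).step)^[n] (some (φ C)) = some (φ D)
  | 0, C, D, h, _ => by
    have hCD : C = D := Option.some.inj h
    subst hCD; rfl
  | n + 1, ⟨none, v, S⟩, D, h, _ => by
    rw [TM2Comp.iterate_bind_succ, step_none, TM2Comp.iterate_bind_none] at h; cases h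
  | n + 1, ⟨some l, v, S⟩, D, h, hD => by
    rw [TM2Comp.iterate_bind_succ] at h ⊢
    rw [step_some] at h
    rw [step_φ_some, divert, if_neg (not_halted_of_iterate tm h hD)]
    exact iterate_φ_of_iterate n _ h hD

open scoped Classical in
/-- **Runs, backward**: a run of the guarded machine from an embedded configuration either is the
embedding of a run of `tm` or has entered the looping label. [folklore] -/
theorem of_iterate_φ : ∀ (n : ℕ) (C : tm.Cfg) {E : (guard tm).Cfg},
    (flip bind (guard tm).step)^[n] (some (φ C)) = some E →
      (∃ D : tm.Cfg, (flip bind tm.step)^[n] (some C) = some D ∧ E = φ D) ∨ E.l = some none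
  | 0, C, E, h => Or.inl ⟨C, rfl, (Option.some.inj h).symm⟩
  | n + 1, ⟨none, v, S⟩, E, h => by
    rw [TM2Comp.iterate_bind_succ, step_φ_none, TM2Comp.iterate_bind_none] at h; cases h
  | n + 1, ⟨some l, v, S⟩, E, h => by
    rw [TM2Comp.iterate_bind_succ, step_φ_some, divert] at h
    by_cases hc : (TM2.stepAux (tm.m l) v S).l = none ∧ (TM2.stepAux (tm.m l) v S).var ≠ tm.initialState
    · rw [if_pos hc] at h
      have h2 := iterate_loop tm (TM2.stepAux (tm.m l) v S).var (TM2.stepAux (tm.m l) v S).stk n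
      have hE : some (⟨some none, (TM2.stepAux (tm.m l) v S).var, (TM2.stepAux (tm.m l) v S).stk⟩ :
          (guard tm).Cfg) = some E := h2.symm.trans h
      cases hE
      exact Or.inr rfl
    · rw [if_neg hc] at h
      rcases of_iterate_φ n _ h with ⟨D, hD, hE⟩ | hE
      · refine Or.inl ⟨D, ?_, hE⟩
        rw [TM2Comp.iterate_bind_succ, step_some]
        exact hD
      · exact Or.inr hE

/-- The embedded initial configuration is the initial configuration. [folklore] -/
theorem φ_initList (L : List (tm.Γ tm.k₀)) : φ (initList tm L) = initList (guard tm) L := by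
  rw [TM2Comp.initList_eq, TM2Comp.initList_eq]
  rfl

/-- The embedded halting configuration is the halting configuration. [folklore] -/
theorem φ_haltList (L : List (tm.Γ tm.k₁)) : φ (haltList tm L) = haltList (guard tm) L := by
  rw [TM2Comp.haltList_eq, TM2Comp.haltList_eq]
  rfl

/-- **The guarded machine has the same outputs within the same time.** [folklore] -/
theorem outputsInTime_iff {L : List (tm.Γ tm.k₀)} {L' : List (tm.Γ tm.k₁)} {m : ℕ} :
    Nonempty (TM2OutputsInTime (guard tm) L (some L') m) ↔ Nonempty (TM2OutputsInTime tm L (some L') m) := by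
  constructor
  · rintro ⟨⟨⟨n, hev⟩, hle⟩⟩
    have hev' : (flip bind (guard tm).step)^[n] (some (φ (initList tm L))) = some (φ (haltList tm L')) := by
      rw [φ_initList, φ_haltList]; exact hev
    rcases of_iterate_φ tm n _ hev' with ⟨D, hD, hE⟩ | hE
    · have hD' : haltList tm L' = D := φ_injective hE
      subst hD'
      exact ⟨⟨⟨n, hD⟩, hle⟩⟩
    · exact absurd hE (φ_l_ne_loop _)
  · rintro ⟨⟨⟨n, hev⟩, hle⟩⟩
    have h := iterate_φ_of_iterate tm n _ hev (fun _ => by rw [TM2Comp.haltList_eq])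
    rw [φ_initList, φ_haltList] at h
    exact ⟨⟨⟨n, h⟩, hle⟩⟩

end Machine

/-! ### Bundled machines -/

variable {Γ₀ Γ₁ : Type}

/-- The guarded bundled machine: same input/output alphabet identifications. [folklore] -/
def guardAux (M : TM2ComputableAux Γ₀ Γ₁) : TM2ComputableAux Γ₀ Γ₁ where
  tm := guard M.tm
  inputAlphabet := M.inputAlphabet
  outputAlphabet := M.outputAlphabet

/-- **The guarded machine computes the same outputs within the same time.** [folklore] -/
theorem outputsWithin_guardAux_iff (M : TM2ComputableAux Γ₀ Γ₁) {x : List Γ₀} {y : List Γ₁} {m : ℕ} :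
    (guardAux M).OutputsWithin x y m ↔ M.OutputsWithin x y m :=
  outputsInTime_iff M.tm

/-- **The guarded machine is proper**: it halts only in its initial state. [folklore] -/
theorem guardAux_proper (M : TM2ComputableAux Γ₀ Γ₁) {X Y : (guardAux M).tm.Cfg}
    (h : (guardAux M).tm.step X = some Y) (hY : Y.l = none) : Y.var = (guardAux M).tm.initialState :=
  proper M.tm h hY

end HaltGuard

end Literature.Computability.Complexity
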